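import Summits.BirchSwinnertonDyer.BirchSwinnertonDyer.Theorems.ByReductionTypeAtTwoTorsionEulerCharH46LevelZero
import Summits.BirchSwinnertonDyer.BirchSwinnertonDyer.Theorems.ByReductionTypeAtTwoTorsionEulerCharH46AtPDual
import Summits.BirchSwinnertonDyer.BirchSwinnertonDyer.Theorems.ByReductionTypeAtTwoTorsionEulerCharH46Assembly
import Summits.BirchSwinnertonDyer.BirchSwinnertonDyer.Theorems.ByReductionTypeAtTwoTorsionEulerCharH46ObstructionReduce
import Summits.BirchSwinnertonDyer.BirchSwinnertonDyer.Theorems.ByReductionTypeAtTwoTorsionEulerCharFact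
import Summits.BirchSwinnertonDyer.BirchSwinnertonDyer.Theorems.ThetaPartnerAtTwoSignedControlAtTwoCasselsLocalTerms
import Literature.NumberTheory.EllipticCurves.LambdaAdicSelmerDataTorsionPowReduce
import Literature.NumberTheory.EllipticCurves.IsogenyFrobeniusTraceProofs
import HarnessLib

set_option linter.dupNamespace false -- `…BirchSwinnertonDyer.BirchSwinnertonDyer…` is the cell's nested layout (D-0017)
set_option autoImplicit false

/-!
# H46 kernel programme (road C′): Greenberg's Lemma 4.6 at one auxiliary place — `H46(W, p, κ, v₀)` — under (T₁)

Cell `bsd-2adic` (run/shared/lean/pub/bsd-2adic/), seat `bsd-2adic-tower-1` GEN 35; `--supports stmt-BirchSwinnertonDyer-19271`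
(helper, item `OrdKatoHalfAtTwo`, TOWER road). THEOREMS ONLY (no definition, no named fact, no instance, no `sorry`); closes no item;
nothing booked; BSD is not proved by any of this.

The GLUE of the kernel programme. For `E/ℚ` (globally minimal Weierstrass model `W`) with good ORDINARY reduction at `p`, `κ` the
cyclotomic `ℤ_p`-extension, `Sel_{p^∞}(E/ℚ)` finite, and the hypothesis

  (T₁) `E(ℚ)[p^∞] ∩ E₁(ℚ_p) = 0`: a `Γ_ℚ`-invariant `p`-power torsion point of `E(ℚ̄)` whose image in `E(ℚ̄_p)` lies in the kernel of
       reduction is `0` (stated on `W.geomPoints` with `pointsMap`/`localKernelOfReduction` at the place `vp ∋ p`),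

**`H46(W, p, κ, v₀)` holds at EVERY good place `v₀ ∉ S`** (`lemma46At_of_T1`): every `p`-power-torsion class
`z ∈ H¹(Γ_{ℚ_{v₀}}, E(ℚ̄_{v₀}))` is the restriction at `v₀` of (every conjugate of) a class `T ∈ H¹(ℚ_∞, E[p^∞])` that is Kummer at all
`v ≠ v₀` and at `∞` — the hypothesis `h46` of `TorsionEulerChar.charValue_rankZero_of_lemma46` /
`twoAdicEulerCharRankZero_of_lemma46` (`…TorsionEulerCharFact`). Assembly: `H46Assembly.exists_realiser_of_sockets` (p735305) at the
level `n = 0`, `k = N = c + j` (`p^j z = 0`), `Sp = {vp}`, with the sockets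
* (HP) `Lp` = Greenberg-STRICT layer classes at `p` (`H46AtP.conjH1_realiser_mem_localKerOver_of_localization_shapiroLift_mem`,
  p738063) and its dual half `hLdual` (`H46AtP.mem_strictKer_of_localization_coindTateDual_mem_dualLocalCondition`, p738697; uses
  `p ∤ a_p`);
* (HB6) = B6a (`H46Obstruction.canonical_cupProduct_incl_eq_zero_of_cores_reduce_eq_zero`, p735807) ∘ the level-zero vanishing
  `H46LevelZero.exists_cores_reduce_eq_zero` (this is where (T₁) enters), with `ι = W.torsionInclusion` (`E[p^j] ↪ E[p^N]`),
  `r = W.torsionGaloisModulePowReduce p N j` (`p^{N-j}`), `zt = ι_* zt_j`, `zt_j` a lift of `z` to `H¹(ℚ_{v₀}, E[p^j])`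
  (`H46Assembly.exists_eq_resTop_kummer_of_zsmul_eq_zero`), and `κ^{(N)} ∘ ι_* = κ^{(j)}`
  (`SignedEC.CasselsPT.map_torsionPointsMapIntertwining_map_torsionInclusion`).

Corollaries: `t1_of_ratPoints` ((T₁) from its rational-point form), `exists_lemma46_of_T1` (some good `v₀ ∤ p`), `charValue_rankZero_of_T1` (Greenberg's Thm. 4.1 display in `ℚ_p`, every
good ordinary `p`, ANY rational `p`-torsion, modulo (T₁)), `twoAdicEulerCharRankZero_of_T1` (`p = 2`: the display
`X5.O1.TwoAdicEulerCharRankZero W 0` modulo (T₁) at `2`). (T₁) is automatic for odd `p` (`Ê(pℤ_p)` is torsion free, Silverman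
IV.6.1 / VII.3.1 — not yet in the tree) and holds for `p = 2` whenever no rational `2`-power torsion point reduces to `Õ` mod `2`.
[cite: GreenbergLNM1716, §4 Lemma 4.6 (p. 105), Thm. 4.1 (p. 102)] [cite: SilvermanAEC2009, Prop. VII.3.1, Thm. IV.6.1]
-/

noncomputable section

open scoped Classical NumberField ContRepresentation

namespace Summit.BirchSwinnertonDyer.BirchSwinnertonDyer.Theorems

namespace TorsionEulerChar.H46LevelZero

open CategoryTheory Field NumberField IsDedekindDomain WeierstrassCurve
  Literature.NumberTheory.EllipticCurves Literature.NumberTheory.EllipticCurves.CyclotomicLayer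
  Literature.NumberTheory.EllipticCurves.GreenbergSelmer
  Literature.NumberTheory.GaloisRepresentations Literature.NumberTheory.GaloisRepresentations.DiscreteGaloisModule
  Literature.NumberTheory.GaloisCohomology ZpExtension
open _root_.TopRep _root_.ContinuousCohomology
open Literature.Algebra.Homology.DiscreteRep (toTopRepHom)

section Main

variable (W : WeierstrassCurve ℚ) [W.IsElliptic] [W.IsGloballyMinimal] (p : ℕ) [hp : Fact p.Prime] (κ : ZpExtension ℚ p)
  (hκ : κ.IsCyclotomic) (hord : IsOrdinaryAt W p) (S : Finset (HeightOneSpectrum (𝓞 ℚ)))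
  (hS : ∀ v : HeightOneSpectrum (𝓞 ℚ), v ∉ S → ((p : ℕ) : 𝓞 ℚ) ∉ v.asIdeal ∧ W.HasGoodReductionAt v)
  (v₀ : HeightOneSpectrum (𝓞 ℚ)) (hv₀ : v₀ ∉ S) (vp : HeightOneSpectrum (𝓞 ℚ)) (hvp : ((p : ℕ) : 𝓞 ℚ) ∈ vp.asIdeal)

include hκ hord hS hv₀ hvp in
/-- **`H46(W, p, κ, v₀)` under (T₁)** at every good place `v₀ ∉ S` (`S ⊇` bad places `∪ {p}`): for `E/ℚ` with good ordinary
reduction at `p`, `κ` cyclotomic, `Sel_{p^∞}(E/ℚ)` finite and (T₁) `E(ℚ)[p^∞] ∩ E₁(ℚ_p) = 0`, every `p`-power-torsion class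
`z ∈ H¹(Γ_{ℚ_{v₀}}, E(ℚ̄_{v₀}))` is realised: there is `T ∈ H¹(ℚ_∞, E[p^∞])` all of whose conjugates are Kummer at every finite `v ≠ v₀`
and at `∞` and restrict at `v₀` to `z`. See the module docstring for the assembly.
[cite: GreenbergLNM1716, §4 Lemma 4.6 (p. 105)] [cite: MilneADT2006, Ch. I, Thm. 4.10] -/
theorem lemma46At_of_T1 [Finite (W.selmerGroupPInfty p)]
    (hT1 : ∀ P : W.geomPoints, (∀ σ : absoluteGaloisGroup ℚ, σ • P = P) → (∃ t : ℕ, p ^ t • P = 0) →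
      pointsMap W (vp.adicCompletion ℚ) P ∈ W.localKernelOfReduction vp → P = 0)
    (z : discreteH1 (localSubgroup (⊤ : Subgroup (absoluteGaloisGroup ℚ)) (v₀.adicCompletion ℚ))
      (localPoints W (v₀.adicCompletion ℚ))) (hz : ∃ k : ℕ, p ^ k • z = 0) :
    ∃ T : W.subgroupH1 p κ.kerSubgroup,
      (∀ v : HeightOneSpectrum (𝓞 ℚ), v ≠ v₀ → ∀ σ : absoluteGaloisGroup ℚ,
        W.conjH1 p κ.kerSubgroup σ T ∈ W.localKerOver p κ.kerSubgroup (v.adicCompletion ℚ)) ∧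
      (∀ (w : InfinitePlace ℚ) (σ : absoluteGaloisGroup ℚ),
        W.conjH1 p κ.kerSubgroup σ T ∈ W.localKerOver p κ.kerSubgroup w.Completion) ∧
      ∀ σ : absoluteGaloisGroup ℚ,
        W.localResOver p κ.kerSubgroup (v₀.adicCompletion ℚ) (W.conjH1 p κ.kerSubgroup σ T) =
          Literature.NumberTheory.EllipticCurves.resOfLe (localPoints W (v₀.adicCompletion ℚ))
            (Subgroup.comap_mono le_top :
              localSubgroup κ.kerSubgroup (v₀.adicCompletion ℚ) ≤
                localSubgroup (⊤ : Subgroup (absoluteGaloisGroup ℚ)) (v₀.adicCompletion ℚ)) z := by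
  obtain ⟨j, hj⟩ := hz
  -- instances (kept as `haveI`, the file declares none)
  haveI : CompactSpace (absoluteGaloisGroup ℚ) := absoluteGaloisGroup_compactSpace ℚ
  haveI : CompactSpace (absoluteGaloisGroup (v₀.adicCompletion ℚ)) := absoluteGaloisGroup_compactSpace _
  haveI : CompactSpace (absoluteGaloisGroup (vp.adicCompletion ℚ)) := absoluteGaloisGroup_compactSpace _
  haveI : Fintype (absoluteGaloisGroup ℚ ⧸ κ.layerSubgroup 0) :=
    @Fintype.ofFinite _ (Subgroup.quotient_finite_of_isOpen _ (κ.isOpen_layerSubgroup 0))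
  obtain ⟨s, hs, hs1⟩ := exists_reps_one (κ.layerSubgroup 0)
  -- the place `vp ∈ S`, good ordinary data at `vp`
  have hvpS : vp ∈ S := by
    by_contra h
    exact (hS vp h).1 hvp
  have hgoodp : W.HasGoodReductionAt vp := (W.hasGoodReductionAt_and_hasUnitRootAt_of_rat hord.1 hord.2 vp hvp).1
  have hordp : ¬ ((p : ℤ) ∣ W.frobeniusTraceAt vp) := by
    rw [W.frobeniusTraceAt_eq_frobeniusTrace vp, Rat.HeightOneSpectrum.primesEquiv_eq_of_natCast_mem vp hp.out hvp]
    exact hord.2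
  -- lift `z` to `zt_j ∈ H¹(ℚ_{v₀}, E[p^j])`
  have hm : (((p ^ j : ℕ) : ℤ)) ≠ 0 := by exact_mod_cast pow_ne_zero j hp.out.ne_zero
  have hz' : ((p ^ j : ℕ) : ℤ) • z = 0 := by rw [natCast_zsmul]; exact hj
  obtain ⟨ztj, hztj⟩ := @H46Assembly.exists_eq_resTop_kummer_of_zsmul_eq_zero ℚ _ _ W _ (v₀.adicCompletion ℚ) _ _
    (charZero_of_injective_algebraMap (algebraMap ℚ (v₀.adicCompletion ℚ)).injective) _ hm z hz'
  -- the level `N = c + j`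
  obtain ⟨c, hc⟩ := exists_cores_reduce_eq_zero W p κ hκ hord S hS v₀ hv₀ vp hvp hT1
  have hjN : j ≤ c + j := Nat.le_add_left j c
  haveI : NeZero (p ^ (c + j)) := ⟨pow_ne_zero _ hp.out.ne_zero⟩
  haveI : Finite (W.geomTorsion ((p ^ (c + j) : ℕ) : ℤ)) := finite_geomTorsion_of_neZero W (p ^ (c + j))
  haveI : Finite (W.geomTorsion ((p : ℤ) ^ (c + j))) := by
    rw [← Nat.cast_pow]; exact finite_geomTorsion_of_neZero W (p ^ (c + j))
  -- `ι : E[p^j] ↪ E[p^N]`, `r = p^{N-j} : E[p^N] → E[p^j]`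
  have hdvd : ((p ^ j : ℕ) : ℤ) ∣ ((p ^ (c + j) : ℕ) : ℤ) := Int.natCast_dvd_natCast.2 (pow_dvd_pow p hjN)
  have hι : ∀ P : W.geomTorsion ((p ^ j : ℕ) : ℤ),
      ((W.torsionInclusion hdvd P : W.geomTorsion ((p ^ (c + j) : ℕ) : ℤ)) : W.geomPoints) = (P : W.geomPoints) := fun _ ↦ rfl
  have hr : ∀ P : W.geomTorsion ((p ^ (c + j) : ℕ) : ℤ),
      (((W.torsionGaloisModulePowReduce p (c + j) j hjN :
          (W.torsionGaloisModule ((p ^ (c + j) : ℕ) : ℤ)).toContRepresentation →ⁱL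
            (W.torsionGaloisModule ((p ^ j : ℕ) : ℤ)).toContRepresentation) P : W.geomTorsion ((p ^ j : ℕ) : ℤ)) : W.geomPoints) =
        ((p ^ (c + j - j) : ℕ) : ℤ) • (P : W.geomPoints) := fun P ↦ by
    rw [Nat.cast_pow]; rfl
  -- `κ^{(N)} (ι_* zt_j) = κ^{(j)} zt_j`
  have hkey : galoisCohomology.map (W.torsionPointsMapIntertwining ((p ^ (c + j) : ℕ) : ℤ) (v₀.adicCompletion ℚ)) 1
      (cohomologyMap ((TopRep.resFunctor (absGaloisRestrict ℚ (v₀.adicCompletion ℚ) :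
          absoluteGaloisGroup (v₀.adicCompletion ℚ) →* absoluteGaloisGroup ℚ)).map
        (toTopRepHom (W.torsionGaloisModule ((p ^ j : ℕ) : ℤ)) (W.torsionGaloisModule ((p ^ (c + j) : ℕ) : ℤ))
          (W.torsionInclusion hdvd))) 1 ztj) =
      galoisCohomology.map (W.torsionPointsMapIntertwining ((p ^ j : ℕ) : ℤ) (v₀.adicCompletion ℚ)) 1 ztj :=
    SignedEC.CasselsPT.map_torsionPointsMapIntertwining_map_torsionInclusion W (v₀.adicCompletion ℚ) hdvd ztj
  -- the assembly
  obtain ⟨T, h1, h2, h3⟩ := H46Assembly.exists_realiser_of_sockets W p κ hκ 0 (c + j) hs hs1 S {vp}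
    (Finset.singleton_subset_iff.2 hvpS) hS v₀ hv₀
    -- (HP) `Lp`: Greenberg-strict layer classes at `p`
    (fun v => AddSubgroup.comap
      (cohomologyMap (coindFinPull (W.torsionGaloisModule ((p ^ (c + j) : ℕ) : ℤ)).toTopRep (κ.layerSubgroup 0)
        (resGalOfEmb (closureEmb (K := ℚ) (v.adicCompletion ℚ)))
        (X' := localRepOf (W.torsionGaloisModule ((p ^ (c + j) : ℕ) : ℤ)) v)
        (TopRep.ofHom ⟨ContinuousLinearMap.id ℤ (W.geomTorsion ((p ^ (c + j) : ℕ) : ℤ)), fun _ => rfl⟩) (layerGroup κ v 0)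
        (fun _ h => h)) 1).hom.toLinearMap.toAddMonoidHom
      (AddSubgroup.map (layerShapiroOf (W.torsionGaloisModule ((p ^ (c + j) : ℕ) : ℤ)) κ v 0).toAddMonoidHom
        (cohomologyMap (subgroupRepMap
          (ContinuousRep.mkQHom (GaloisRep.restrictField (v.adicCompletion ℚ) (W.torsionGaloisModule ((p ^ (c + j) : ℕ) : ℤ)))
            (AddSubgroup.toIntSubmodule (W.kernelOfReductionLocalDatumTorsion ((p ^ (c + j) : ℕ) : ℤ) v).plus)
            (H46AtP.plus_toIntSubmodule_le_comap W ((p ^ (c + j) : ℕ) : ℤ) v)) (layerGroup κ v 0)) 1).hom.toLinearMap.toAddMonoidHom.ker))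
    -- `Λp`: strict at `p`
    (fun v b => b ∈ (W.kernelOfReductionLocalDatumTorsion ((p ^ (c + j) : ℕ) : ℤ) v).strictKer (κ.layerSubgroup 0))
    -- `hLdual`
    (fun v hv b hdual => by
      obtain rfl : v = vp := Finset.mem_singleton.1 hv
      exact H46AtP.mem_strictKer_of_localization_coindTateDual_mem_dualLocalCondition W p κ hκ 0 (c + j) hs hs1 v hvp hgoodp
        hordp b hdual)
    -- `hP`
    (fun v hv b hb σ => by
      obtain rfl : v = vp := Finset.mem_singleton.1 hv
      exact H46AtP.conjH1_realiser_mem_localKerOver_of_localization_shapiroLift_mem W p κ hκ 0 (c + j) hs hs1 v hvp hgoodp b hb σ)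
    -- `zt = ι_* zt_j`
    (cohomologyMap ((TopRep.resFunctor (absGaloisRestrict ℚ (v₀.adicCompletion ℚ) :
        absoluteGaloisGroup (v₀.adicCompletion ℚ) →* absoluteGaloisGroup ℚ)).map
      (toTopRepHom (W.torsionGaloisModule ((p ^ j : ℕ) : ℤ)) (W.torsionGaloisModule ((p ^ (c + j) : ℕ) : ℤ))
        (W.torsionInclusion hdvd))) 1 ztj)
    -- (HB6) = B6a ∘ level-zero vanishing
    (fun b hunr hΛ =>
      H46Obstruction.canonical_cupProduct_incl_eq_zero_of_cores_reduce_eq_zero W p hjN (κ.layerSubgroup 0)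
        (κ.isOpen_layerSubgroup 0) v₀ (W.torsionInclusion hdvd) hι _ hr ztj b
        (hc j (c + j) le_rfl hs hs1 _ hr b hunr (hΛ vp (Finset.mem_singleton_self vp))))
  refine ⟨T, h1, h2, fun σ ↦ ?_⟩
  rw [h3 σ, ← hztj, hkey]

end Main

/-! ## Corollaries: some good `v₀`; the Euler-characteristic displays modulo (T₁) -/

section Corollaries

/-- **(T₁) from rational points.** By Galois descent (`mem_range_toGeomPoints_iff`: the `Γ_ℚ`-fixed points of `E(ℚ̄)` are the image of
`E(ℚ)`), hypothesis (T₁) is implied by — indeed equivalent to — its rational-point form: every rational point `P ∈ E(ℚ)` whose image in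
`E(ℚ̄)` is `p`-power torsion and maps into the kernel of reduction `E₁(ℚ̄_p)` is `O` («`E(ℚ)[p^∞] ∩ E₁(ℚ_p) = 0`»).
[cite: SilvermanAEC2009, VIII.§1, Prop. VII.3.1] -/
theorem t1_of_ratPoints (W : WeierstrassCurve ℚ) (p : ℕ) (vp : HeightOneSpectrum (𝓞 ℚ))
    (hT1' : ∀ P : W.toAffine.Point, (∃ t : ℕ, p ^ t • toGeomPoints W P = 0) →
      pointsMap W (vp.adicCompletion ℚ) (toGeomPoints W P) ∈ W.localKernelOfReduction vp → P = 0) :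
    ∀ P : W.geomPoints, (∀ σ : absoluteGaloisGroup ℚ, σ • P = P) → (∃ t : ℕ, p ^ t • P = 0) →
      pointsMap W (vp.adicCompletion ℚ) P ∈ W.localKernelOfReduction vp → P = 0 := by
  intro P hfix htors hker
  obtain ⟨P₀, rfl⟩ := (W.mem_range_toGeomPoints_iff P).2 (MulAction.mem_fixedPoints.2 hfix)
  rw [hT1' P₀ htors hker, map_zero]

/-- **`∃` a good place `v₀ ∤ p` with `H46(W, p, κ, v₀)`, under (T₁)** — the hypothesis `h46` of the per-curve
`…TorsionEulerCharFact` doors (`charValue_rankZero_of_lemma46`, `twoAdicEulerCharRankZero_of_lemma46`).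
[cite: GreenbergLNM1716, §4 Lemma 4.6 (p. 105)] -/
theorem exists_lemma46_of_T1 (W : WeierstrassCurve ℚ) [W.IsElliptic] [W.IsGloballyMinimal] (p : ℕ) [hp : Fact p.Prime]
    (hord : IsOrdinaryAt W p) (κ : ZpExtension ℚ p) (hκ : κ.IsCyclotomic) [Finite (W.selmerGroupPInfty p)]
    (vp : HeightOneSpectrum (𝓞 ℚ)) (hvp : ((p : ℕ) : 𝓞 ℚ) ∈ vp.asIdeal)
    (hT1 : ∀ P : W.geomPoints, (∀ σ : absoluteGaloisGroup ℚ, σ • P = P) → (∃ t : ℕ, p ^ t • P = 0) →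
      pointsMap W (vp.adicCompletion ℚ) P ∈ W.localKernelOfReduction vp → P = 0) :
    ∃ v₀ : HeightOneSpectrum (𝓞 ℚ), ((p : ℕ) : 𝓞 ℚ) ∉ v₀.asIdeal ∧ W.HasGoodReductionAt v₀ ∧
      ∀ z : discreteH1 (localSubgroup (⊤ : Subgroup (absoluteGaloisGroup ℚ)) (v₀.adicCompletion ℚ))
        (localPoints W (v₀.adicCompletion ℚ)), (∃ k : ℕ, p ^ k • z = 0) →
      ∃ T : W.subgroupH1 p κ.kerSubgroup,
        (∀ v : HeightOneSpectrum (𝓞 ℚ), v ≠ v₀ → ∀ σ : absoluteGaloisGroup ℚ,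
          W.conjH1 p κ.kerSubgroup σ T ∈ W.localKerOver p κ.kerSubgroup (v.adicCompletion ℚ)) ∧
        (∀ (w : InfinitePlace ℚ) (σ : absoluteGaloisGroup ℚ),
          W.conjH1 p κ.kerSubgroup σ T ∈ W.localKerOver p κ.kerSubgroup w.Completion) ∧
        ∀ σ : absoluteGaloisGroup ℚ,
          W.localResOver p κ.kerSubgroup (v₀.adicCompletion ℚ) (W.conjH1 p κ.kerSubgroup σ T) =
            Literature.NumberTheory.EllipticCurves.resOfLe (localPoints W (v₀.adicCompletion ℚ))
              (Subgroup.comap_mono le_top :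
                localSubgroup κ.kerSubgroup (v₀.adicCompletion ℚ) ≤
                  localSubgroup (⊤ : Subgroup (absoluteGaloisGroup ℚ)) (v₀.adicCompletion ℚ)) z := by
  obtain ⟨S, v₀, hS, hv₀⟩ := exists_finset_place W p
  exact ⟨v₀, (hS v₀ hv₀).1, (hS v₀ hv₀).2, fun z hz ↦ lemma46At_of_T1 W p κ hκ hord S hS v₀ hv₀ vp hvp hT1 z hz⟩

/-- **Greenberg's Thm. 4.1 display in `ℚ_p`, every good ordinary `p`, ANY rational `p`-torsion, modulo (T₁)**:
`fE(0) · #E(ℚ)(p)² = u · p^{ord_p ∏ c_ℓ} · #Ẽ(𝔽_p)(p)² · #Sel_{p^∞}(E/ℚ)`, `u ∈ ℤ_pˣ` (`charValue_rankZero_of_lemma46` with `h46`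
discharged by `exists_lemma46_of_T1`). [cite: GreenbergLNM1716, Thm. 4.1 (p. 102), §4 Lemmas 4.6–4.7 (pp. 105–108)] -/
theorem charValue_rankZero_of_T1 (p : ℕ) [hp : Fact p.Prime] (W : WeierstrassCurve ℚ) [W.IsGloballyMinimal] [W.IsElliptic]
    (hgo : Rank1Residual.GoodOrd W p) (κ : ZpExtension ℚ p) (hκ : κ.IsCyclotomic) {γ : absoluteGaloisGroup ℚ} (hγ : κ.IsTopGenerator γ)
    (D : W.SelmerDualData κ γ) [Finite (W.selmerGroupPInfty p)]
    (vp : HeightOneSpectrum (𝓞 ℚ)) (hvp : ((p : ℕ) : 𝓞 ℚ) ∈ vp.asIdeal)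
    (hT1 : ∀ P : W.geomPoints, (∀ σ : absoluteGaloisGroup ℚ, σ • P = P) → (∃ t : ℕ, p ^ t • P = 0) →
      pointsMap W (vp.adicCompletion ℚ) P ∈ W.localKernelOfReduction vp → P = 0)
    (fE : IwasawaAlgebra p) (hf : D.charIdeal = Ideal.span {fE}) :
    ∃ u : ℤ_[p]ˣ,
      ((PowerSeries.constantCoeff fE : ℤ_[p]) : ℚ_[p]) *
          (Nat.card (AddCommGroup.primaryComponent W.toAffine.Point p) : ℚ_[p]) ^ 2 =
        ((u : ℤ_[p]) : ℚ_[p]) * (p : ℚ_[p]) ^ (padicValNat p W.tamagawaProduct) *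
          (Nat.card (AddCommGroup.primaryComponent
            ((integralModelInt W).map (Int.castRingHom (ZMod p))).toAffine.Point p) : ℚ_[p]) ^ 2 *
          (Nat.card (W.selmerGroupPInfty p) : ℚ_[p]) := by
  have hord : IsOrdinaryAt W p := hgo
  obtain ⟨v₀, hpv₀, hgood₀, h46⟩ := exists_lemma46_of_T1 W p hord κ hκ vp hvp hT1
  exact charValue_rankZero_of_lemma46 p W hgo κ hκ hγ D v₀ hpv₀ hgood₀ h46 fE hf

open Summit.BirchSwinnertonDyer.Rank1Residual.X5.O1 in
/-- **`p = 2`: Greenberg's rank-`0` Euler-characteristic display `TwoAdicEulerCharRankZero W 0` modulo (T₁) at `2`** (rational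
`2`-torsion ALLOWED as long as no rational `2`-power torsion point reduces to `Õ` mod `2`): `twoAdicEulerCharRankZero_of_lemma46` with
`h46` discharged by `exists_lemma46_of_T1`. [cite: GreenbergLNM1716, Thm. 4.1 (p. 102), §4 Lemmas 4.6–4.7 (pp. 105–108)] -/
theorem twoAdicEulerCharRankZero_of_T1 (W : WeierstrassCurve ℚ) [W.IsElliptic] [W.IsGloballyMinimal]
    (v2 : HeightOneSpectrum (𝓞 ℚ)) (hv2 : ((2 : ℕ) : 𝓞 ℚ) ∈ v2.asIdeal)
    (hT1 : ∀ P : W.geomPoints, (∀ σ : absoluteGaloisGroup ℚ, σ • P = P) → (∃ t : ℕ, 2 ^ t • P = 0) →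
      pointsMap W (v2.adicCompletion ℚ) P ∈ W.localKernelOfReduction v2 → P = 0) :
    TwoAdicEulerCharRankZero W 0 :=
  twoAdicEulerCharRankZero_of_lemma46 W fun hgo κ hκ hSel ↦ by
    haveI := hSel
    have hord : IsOrdinaryAt W 2 := hgo
    exact exists_lemma46_of_T1 W 2 hord κ hκ v2 hv2 hT1

end Corollaries

end TorsionEulerChar.H46LevelZero

end Summit.BirchSwinnertonDyer.BirchSwinnertonDyer.Theorems
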